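import Summits.AtomisticToContinuum.Crystallization.Theorems.FrustratedLawDichotomyStrainedPatchHomWrecCurvature

/-!
# The THIRD derivative of the record potential `W₄₅` in closed form, regime by regime (input of the Lipschitz-Hessian leaf of lever (C))

decomp-a2c hand-1 g26 (crux `AperiodicFrustratedLawGap`, stmt-AtomisticToContinuum-27623; `(H) HomFloor (1/625)`, hcp half; critic rows 1040 (b) /
1044: the production curvature leaf bounds `H(U, ξ) ⪰ H_c − ρ_L·1` with `ρ_L` from label sums of THIRD-ORDER closed-form bounds).  Differentiating the
open-regime closed forms of `W₄₅″` (`…HomWrecCurvature.hasDerivAt_deriv_effPot45_*`):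

* bump `0 < r < 8/5`: `W₄₅‴ = −182r⁻¹⁵ + 56r⁻⁹ − (3/160)(5/4)²·P‴(5r/4)`, `P‴(u) = 99/2 u − 1155/16 u² + 3465/128 u⁴ − 693/128 u⁶ + 2475/6144 u⁸`;
* Lennard-Jones `8/5 < r < 3`: `W₄₅‴ = −182r⁻¹⁵ + 56r⁻⁹`;
* window `3 < r < 9/2`: `W₄₅‴ = (−182r⁻¹⁵ + 56r⁻⁹)c + 3(13r⁻¹⁴ − 7r⁻⁸)c′ + 3(−r⁻¹³ + r⁻⁷)c″ + V·(32/9)` (`c, c′, c″` as in `…HomWrecCurvature`);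
* far `9/2 < r`: `W₄₅‴ = 0`.

NO definitions; 0 sorry; standard axioms; no instances / notation / `#eval`.  `--supports stmt-AtomisticToContinuum-27623`.
-/

noncomputable section

namespace Summit.AtomisticToContinuum.Crystallization.Theorems.FrustratedLawDichotomyStrainedPatchHomWrecCurvature

open Filter Topology
open Literature.MathematicalPhysics.StatisticalMechanics (lennardJones)
open Summit.AtomisticToContinuum.Crystallization.Theorems.FrustratedLawDichotomySchurCut (effPot w₄₅ ω₄)
open Summit.AtomisticToContinuum.Crystallization.Theorems.FrustratedLawDichotomyStrainedPatchHomTermCalculus (hasDerivAt_deriv_lennardJones)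

/-! ## §3. Elementary third derivatives -/

/-- `d/dr (13r⁻¹⁴ − 7r⁻⁸) = −182r⁻¹⁵ + 56r⁻⁹` (`r ≠ 0`). [folklore] -/
theorem hasDerivAt_ljD2 {r : ℝ} (hr : r ≠ 0) :
    HasDerivAt (fun s : ℝ => 13 * (s⁻¹) ^ 14 - 7 * (s⁻¹) ^ 8) (-182 * (r⁻¹) ^ 15 + 56 * (r⁻¹) ^ 9) r := by
  have h1 : HasDerivAt (fun s : ℝ => s⁻¹) (-(r ^ 2)⁻¹) r := hasDerivAt_inv hr
  have h := ((h1.fun_pow 14).const_mul (13 : ℝ)).fun_sub ((h1.fun_pow 8).const_mul (7 : ℝ))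
  refine h.congr_deriv ?_
  have e15 : (r⁻¹) ^ 15 = (r⁻¹) ^ 13 * (r ^ 2)⁻¹ := by rw [← inv_pow]; ring
  have e9 : (r⁻¹) ^ 9 = (r⁻¹) ^ 7 * (r ^ 2)⁻¹ := by rw [← inv_pow]; ring
  rw [e15, e9]
  push_cast
  ring

/-- The bump profile's `(5/4)·P″(5r/4)` has derivative `(5/4)²·P‴(5r/4)`. [folklore] -/
theorem hasDerivAt_bumpPoly2 (r : ℝ) :
    HasDerivAt (fun s : ℝ => 5 / 4 * (-(11 / 3) + 99 / 4 * (5 * s / 4) ^ 2 - 385 / 16 * (5 * s / 4) ^ 3 + 693 / 128 * (5 * s / 4) ^ 5 -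
        99 / 128 * (5 * s / 4) ^ 7 + 275 / 6144 * (5 * s / 4) ^ 9))
      (25 / 16 * (99 / 2 * (5 * r / 4) - 1155 / 16 * (5 * r / 4) ^ 2 + 3465 / 128 * (5 * r / 4) ^ 4 - 693 / 128 * (5 * r / 4) ^ 6 +
        2475 / 6144 * (5 * r / 4) ^ 8)) r := by
  have hu : HasDerivAt (fun s : ℝ => 5 * s / 4) (5 / 4 : ℝ) r := by
    simpa using ((hasDerivAt_id r).const_mul (5 : ℝ)).div_const 4
  have h := (((((((hu.fun_pow 2).const_mul (99 / 4 : ℝ)).const_add (-(11 / 3) : ℝ)).fun_sub ((hu.fun_pow 3).const_mul (385 / 16 : ℝ))).fun_add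
    ((hu.fun_pow 5).const_mul (693 / 128 : ℝ))).fun_sub ((hu.fun_pow 7).const_mul (99 / 128 : ℝ))).fun_add
    ((hu.fun_pow 9).const_mul (275 / 6144 : ℝ))).const_mul (5 / 4 : ℝ)
  refine h.congr_deriv ?_
  push_cast
  ring

/-! ## §4. `W₄₅‴` on the four open regimes -/

/-- ★ **Lennard-Jones regime**: `W₄₅‴(r) = −182r⁻¹⁵ + 56r⁻⁹` on `8/5 < r < 3`. [folklore] -/
theorem hasDerivAt_deriv2_effPot45_lj {r : ℝ} (h1 : 8 / 5 < r) (h2 : r < 3) :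
    HasDerivAt (deriv (deriv (effPot w₄₅ ω₄ (3 / 400)))) (-182 * (r⁻¹) ^ 15 + 56 * (r⁻¹) ^ 9) r := by
  have heq : deriv (deriv (effPot w₄₅ ω₄ (3 / 400))) =ᶠ[𝓝 r] fun s => 13 * (s⁻¹) ^ 14 - 7 * (s⁻¹) ^ 8 := by
    filter_upwards [Ioo_mem_nhds h1 h2] with s hs using (hasDerivAt_deriv_effPot45_lj hs.1 hs.2).deriv
  exact (hasDerivAt_ljD2 (by linarith : r ≠ 0)).congr_of_eventuallyEq heq

/-- ★ **Bump regime**: `W₄₅‴(r) = −182r⁻¹⁵ + 56r⁻⁹ − (3/160)(5/4)²·P‴(5r/4)` on `0 < r < 8/5`. [folklore] -/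
theorem hasDerivAt_deriv2_effPot45_bump {r : ℝ} (h0 : 0 < r) (h1 : r < 8 / 5) :
    HasDerivAt (deriv (deriv (effPot w₄₅ ω₄ (3 / 400))))
      (-182 * (r⁻¹) ^ 15 + 56 * (r⁻¹) ^ 9 - 3 / 160 * (25 / 16 * (99 / 2 * (5 * r / 4) - 1155 / 16 * (5 * r / 4) ^ 2 +
        3465 / 128 * (5 * r / 4) ^ 4 - 693 / 128 * (5 * r / 4) ^ 6 + 2475 / 6144 * (5 * r / 4) ^ 8))) r := by
  have heq : deriv (deriv (effPot w₄₅ ω₄ (3 / 400))) =ᶠ[𝓝 r] fun s => 13 * (s⁻¹) ^ 14 - 7 * (s⁻¹) ^ 8 -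
      3 / 160 * (5 / 4 * (-(11 / 3) + 99 / 4 * (5 * s / 4) ^ 2 - 385 / 16 * (5 * s / 4) ^ 3 + 693 / 128 * (5 * s / 4) ^ 5 -
        99 / 128 * (5 * s / 4) ^ 7 + 275 / 6144 * (5 * s / 4) ^ 9)) := by
    filter_upwards [Ioo_mem_nhds h0 h1] with s hs using (hasDerivAt_deriv_effPot45_bump hs.1 hs.2).deriv
  exact (((hasDerivAt_ljD2 h0.ne').sub ((hasDerivAt_bumpPoly2 r).const_mul (3 / 160 : ℝ)))).congr_of_eventuallyEq heq

/-- ★ **Window regime**: `W₄₅‴ = (−182r⁻¹⁵ + 56r⁻⁹)c + 3(13r⁻¹⁴ − 7r⁻⁸)c′ + 3(−r⁻¹³ + r⁻⁷)c″ + V·(32/9)` on `3 < r < 9/2`. [folklore] -/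
theorem hasDerivAt_deriv2_effPot45_window {r : ℝ} (h1 : 3 < r) (h2 : r < 9 / 2) :
    HasDerivAt (deriv (deriv (effPot w₄₅ ω₄ (3 / 400))))
      ((-182 * (r⁻¹) ^ 15 + 56 * (r⁻¹) ^ 9) * ((16 * r ^ 3 - 180 * r ^ 2 + 648 * r - 729) / 27) +
        3 * (13 * (r⁻¹) ^ 14 - 7 * (r⁻¹) ^ 8) * ((16 * r ^ 2 - 120 * r + 216) / 9) +
        3 * (-(r⁻¹) ^ 13 + (r⁻¹) ^ 7) * ((32 * r - 120) / 9) + lennardJones r * (32 / 9)) r := by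
  have hr : r ≠ 0 := by linarith
  have heq : deriv (deriv (effPot w₄₅ ω₄ (3 / 400))) =ᶠ[𝓝 r] fun s =>
      (13 * (s⁻¹) ^ 14 - 7 * (s⁻¹) ^ 8) * ((16 * s ^ 3 - 180 * s ^ 2 + 648 * s - 729) / 27) +
        2 * (-(s⁻¹) ^ 13 + (s⁻¹) ^ 7) * ((16 * s ^ 2 - 120 * s + 216) / 9) + lennardJones s * ((32 * s - 120) / 9) := by
    filter_upwards [Ioo_mem_nhds h1 h2] with s hs using (hasDerivAt_deriv_effPot45_window hs.1 hs.2).deriv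
  have hid := hasDerivAt_id r
  have hc : HasDerivAt (fun s : ℝ => (16 * s ^ 3 - 180 * s ^ 2 + 648 * s - 729) / 27) ((16 * r ^ 2 - 120 * r + 216) / 9) r := by
    have h := ((((hid.fun_pow 3).const_mul (16 : ℝ)).fun_sub ((hid.fun_pow 2).const_mul (180 : ℝ))).fun_add
      (hid.const_mul (648 : ℝ))).sub_const (729 : ℝ) |>.div_const 27
    refine h.congr_deriv ?_
    simp only [id]; push_cast; ring
  have hc' : HasDerivAt (fun s : ℝ => (16 * s ^ 2 - 120 * s + 216) / 9) ((32 * r - 120) / 9) r := by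
    have h := ((((hid.fun_pow 2).const_mul (16 : ℝ)).fun_sub (hid.const_mul (120 : ℝ))).add_const (216 : ℝ)).div_const 9
    refine h.congr_deriv ?_
    simp only [id]; push_cast; ring
  have hc'' : HasDerivAt (fun s : ℝ => (32 * s - 120) / 9) (32 / 9) r := by
    have h := (((hasDerivAt_id' r).const_mul (32 : ℝ)).sub_const (120 : ℝ)).div_const 9
    exact h.congr_deriv (by ring)
  have hlj : HasDerivAt lennardJones (-(r⁻¹) ^ 13 + (r⁻¹) ^ 7) r := by
    have h1' : HasDerivAt (fun s : ℝ => s⁻¹) (-(r ^ 2)⁻¹) r := hasDerivAt_inv hr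
    have h := ((h1'.fun_pow 12).const_mul (1 / 12 : ℝ)).fun_sub ((h1'.fun_pow 6).const_mul (1 / 6 : ℝ))
    have hfun : lennardJones = fun s : ℝ => (1 / 12 : ℝ) * (s⁻¹) ^ 12 - (1 / 6 : ℝ) * (s⁻¹) ^ 6 := by
      funext s; simp [lennardJones]
    rw [hfun]
    refine h.congr_deriv ?_
    have e13 : (r⁻¹) ^ 13 = (r⁻¹) ^ 11 * (r ^ 2)⁻¹ := by rw [← inv_pow]; ring
    have e7 : (r⁻¹) ^ 7 = (r⁻¹) ^ 5 * (r ^ 2)⁻¹ := by rw [← inv_pow]; ring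
    rw [e13, e7]; push_cast; ring
  have hD1 := hasDerivAt_deriv_lennardJones hr      -- (−r⁻¹³ + r⁻⁷)′ = 13r⁻¹⁴ − 7r⁻⁸
  have h := (((hasDerivAt_ljD2 hr).mul hc).add (((hD1.const_mul (2 : ℝ)).mul hc'))).add (hlj.mul hc'')
  refine (h.congr_of_eventuallyEq ?_).congr_deriv ?_
  · filter_upwards [heq] with s hs
    rw [hs]
    simp only [Pi.add_apply, Pi.mul_apply]
  · ring

/-- ★ **Far regime**: `W₄₅‴(r) = 0` on `9/2 < r`. [folklore] -/
theorem hasDerivAt_deriv2_effPot45_far {r : ℝ} (h : 9 / 2 < r) : HasDerivAt (deriv (deriv (effPot w₄₅ ω₄ (3 / 400)))) 0 r := by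
  have heq : deriv (deriv (effPot w₄₅ ω₄ (3 / 400))) =ᶠ[𝓝 r] fun _ => (0 : ℝ) := by
    filter_upwards [Ioi_mem_nhds h] with s hs using (hasDerivAt_deriv_effPot45_far hs).deriv
  exact (hasDerivAt_const r (0 : ℝ)).congr_of_eventuallyEq heq

end Summit.AtomisticToContinuum.Crystallization.Theorems.FrustratedLawDichotomyStrainedPatchHomWrecCurvature

end
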